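import Summits.HodgeConjecture.HodgeConjecture.Theorems.F0P6aCanonicalTwistIdealArithRows   -- ★ p849355 (LA4-p04): rows of `(𝔞_can, p^f)`; re-exports the `τR` ∕ `closureValuationSubring` currency
import Literature.NumberTheory.GaloisRepresentations.LocalGaloisGroup                        -- ★ `IsAbsArithFrob`
import Literature.NumberTheory.GaloisRepresentations.RayClassIntegralIdeleRepresentative     -- (S6) FILE 1: level-adapted integral representative of a finite idèle
import Literature.NumberTheory.ComplexMultiplication.ReflexNormIdeal                         -- ★ `prod_map_eq_span_absNorm` (Shimura §8.3 Prop. 29)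
import Literature.AlgebraicGeometry.ShimuraVarieties.UnitaryCurveSpecialPairReciprocity      -- ★ `IsArtinCorrespondent.mul_unitEmbedding_inv`
import Literature.AlgebraicGeometry.ShimuraVarieties.UnitaryShimuraCanonicalModelArtin       -- ★ `exists_finiteIdele_isArtinCorrespondent`
import HarnessLib

/-!
# Crux `HLiu418` — P6 sub-line **F0-P6a**, organ (S6) «TWIST DATA» of the sheet line `stub_ESHEET`: the twist data `(𝔞_γ, n_γ)_{γ ∈ Gal(Fᵢ∕F)}`

Cell `hodgecm-mathlib` (D-0151), crux `stmt-HodgeConjecture-24832` (hLiu418), `--supports` only (count-neutral).  «L5» LA5-plan (g3) DEAL L5-#4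
(2026-09-02T05:48Z) → LA7-p02 (g3), from the E-pen A-p01 (g28)՚s organ map `MEMO-ESHEET-organs.v1` §2 (S6) for the socket `stub_ESHEET :
RecordESheetReading` of the X-LEAF `Lines/F0_P6a_EExports.lean` (cand v1 :127–:193; body = E-READINGS ED. 3 `ETwistKerAt` token for token).
THEOREMS ONLY (no definition, no instance, no notation, no named fact, no `sorry`); no `Cruxes/…/Lines` import — the Kottwitz signature and the sheet
group are ABSTRACT (`M : (F →+* L) → ℕ` for `mOf ι₁ Φ`, any `Fi` with an `F`-embedding `e : Fi → F̄_w`).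

THE LETTER asks for `twistIdeal : Gal(Fᵢ∕F) → Ideal (𝓞 F)`, `twistNorm : Gal(Fᵢ∕F) → ℕ` with SEVEN ARITHMETIC ROWS — for every `γ`: (a)
`(n_γ) = 𝔞_γ · c•𝔞_γ`, (b) `𝔞_γ + (N) = (1)`, (c) `𝔞_γ ≠ 0`; for every `γ` READ BY AN ARITHMETIC FROBENIUS `σ` AT `w` ON THE SHEET `e`
(`σ̄ ∘ e = e ∘ γ`): (FROB-𝔞) `𝔭_w ∣ 𝔞_γ`, (FROB-n) `n_γ = p^f`, (π1) `𝔞_γ + 𝔭_{c•w} = (1)`, (FROB-can) `𝔞_γ = 𝔞_can(m, τR, w)` for every `(σ₀, τR)` — and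
TWO GEOMETRIC ROWS (K-law)∕(cover) (the Serre cover `A_{(y,eγ)} ≅ A_{(y,e)} ⊗ 𝔞_γ⁻¹`, [Shimura1998] §13.1 Thm. 1, §18.6 Thm. 18.6; the sheet law of
[RapoportSmithlingZhang2020Diagonal] §4.3 (4.23)).  The mathematics of the choice (A-p01 memo §1–§2): on the Frobenius coset the datum is the
Shimura–Taniyama ideal `(𝔞_can, p^f)` (its six arithmetic rows are ★ p849355 `F0P6aCanonicalTwistIdealArithRows.canonicalTwistIdeal_eLetterRows_sigma`,
its admissibility for the geometric rows is the Frobenius pin (S7) + the inertia consistency); elsewhere it is ANY admissible datum — an integral ideal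
in the class read by CM reciprocity ((S2a): the type norm of a LEVEL-ADAPTED Artin correspondent `s_γ` of an extension `γ̃` of `γ`, `𝔞_γ = N_{Φ′}((s_γ))`,
`s_γ ≡ 1 mod N` so that the level is kept) — with rows (a)(b)(c).

WHAT THIS FILE PAYS.
* §1 THE GENERIC ROWS: for `F ∕ ℚ` Galois CM, a CM type `Φ ⊆ Gal(F∕ℚ)` (`g ∈ Φ ↔ c̄g ∉ Φ`) and ANY integral ideal `𝔟 ≠ 0` with `𝔟 + (N) = (1)`, the
  type product `𝔞 := ∏_{g ∈ Φ} g•𝔟` and `n := N𝔟` satisfy (a)(b)(c) — (a) is [Shimura1998] §8.3 Prop. 29 «`𝔟𝔟^ρ = N(𝔞)`» in the Galois self-case, ONE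
  call of ★ `ReflexNormIdeal.prod_map_eq_span_absNorm` (`span_absNorm_eq_typeProd_mul_complexConj_smul`, `typeProd_sup_span_natCast_eq_top`,
  `typeProd_ne_bot`, ZIP `typeProd_twistRows`).
* §2 THE LEVEL-ADAPTED CORRESPONDENT: every `σ ∈ Aut(ℂ∕τF)` has an Artin correspondent `s` (★ `exists_finiteIdele_isArtinCorrespondent`) with
  `(s) = 𝔟` INTEGRAL and prime to `𝔪` and `s ≡ 1 mod 𝔪` at the primes of `𝔪` (★ `exists_mul_unitEmbedding_integral_congr`, the finite-idèle form of
  Neukirch VI (1.9) + the integral ray-class representative, moved inside the correspondent՚s class by ★ `IsArtinCorrespondent.mul_unitEmbedding_inv`) —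
  the memo՚s §3 (iii) «`z ≡ 1 mod N` by weak approximation inside the idèle class», for ANY given correspondent too
  (`exists_mul_unitEmbedding_isArtinCorrespondent_integral_congr`).
* §3 THE HEADS: `exists_twistData` — the `if`-ZIP over an abstract Frobenius predicate and an abstract admissibility `Adm γ 𝔞 n` (the seam: the
  closer instantiates `Adm` with the class condition its (S3)∕(S4) organs consume; this file never names it) — and **`exists_twistData_letterRows`**:
  the SEVEN ARITHMETIC ROWS OF THE LETTER WITH ITS BINDERS TOKEN FOR TOKEN plus `∀ γ, Adm γ (twistIdeal γ) (twistNorm γ)`, from (i) the six ★ rows of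
  `(𝔞₀, p^f)` (hypotheses `h₀a h₀b h₀c h₀w h₀π h₀can` = the conclusion of ★ `canonicalTwistIdeal_eLetterRows_sigma`, `𝔞₀` its `(σ₁, τR₁)`-token),
  (ii) `h₀adm` «every Frobenius reading of `e` admits `(𝔞₀, p^f)`» (the (S7)∕(b) pin), (iii) `hgen` «every `γ` admits SOME datum with rows (a)(b)(c)»
  (§1 + §2 + the class organ).  Because the `if`-branch IS the rows՚ own hypothesis «∃ σ Frobenius reading γ on e», the four Frobenius rows are the ★
  rows of `𝔞₀` by `rw`, and NO coset-consistency is used by any arithmetic row (it is used only inside `h₀adm`, i.e. by the geometric rows).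

HONEST LABEL.  HC_CM is proved only modulo the 7 printed citations (2 remaining named inputs: hLiu418 = stmt-HodgeConjecture-24832, h413 =
stmt-HodgeConjecture-24833) until rung 0 closes; nothing here changes a count.  NOT here: the class condition `Adm` itself ((S2a)∕(S3)∕(S4)), the
Frobenius pin `h₀adm` ((S7) ★ LA4-p04 + the local–global bridge (b2♯) LA4-p05), the geometric rows.
[cite: Shimura1998, §8.3 Prop. 29 p. 63; §13.1 Thm. 1 pp. 97–99 and (7); §18.6 Thm. 18.6 pp. 124–125] [cite: RapoportSmithlingZhang2020Diagonal, §3.2 p. 11; §4.3 (4.23) p. 21]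
[cite: NeukirchANT1999, Ch. VI §1 Prop. (1.9) pp. 364–365] [cite: Milne2005ShimuraVarieties, (59) p. 107]
-/

set_option autoImplicit false
set_option linter.dupNamespace false  -- `Summit.HodgeConjecture.HodgeConjecture.…` BY DESIGN (D-0017)

noncomputable section

open NumberField IsDedekindDomain IsLocalRing
open scoped Pointwise nonZeroDivisors
open Literature.NumberTheory.GaloisRepresentations (closureValuationSubring IsAbsArithFrob modulusExp)
open Literature.AlgebraicGeometry.ShimuraVarieties (UnitaryCanonicalModel.IsArtinCorrespondent)

namespace Summit.HodgeConjecture.HodgeConjecture.Theorems.F0P6aTwistData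

variable {F : Type} [Field F] [NumberField F] [IsCMField F]

/-! ### §1 Rows (a)(b)(c) for the CM-type product `∏_{g ∈ Φ} g•𝔟` of ANY integral ideal `𝔟` prime to `N` -/

/-- The two costumes of complex conjugation agree on ideals: `(c.restrictScalars ℚ) • 𝔞 = c • 𝔞`. [folklore] -/
theorem restrictScalars_complexConj_smul_ideal (𝔞 : Ideal (𝓞 F)) :
    ((IsCMField.complexConj F).restrictScalars ℚ) • 𝔞 = (IsCMField.complexConj F) • 𝔞 := by
  rw [Ideal.pointwise_smul_def, Ideal.pointwise_smul_def]
  congr 1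

/-- **Row (a) for a CM-type product**: for `F ∕ ℚ` Galois CM, `Φ ⊆ Gal(F∕ℚ)` with `g ∈ Φ ↔ c·g ∉ Φ` (a CM type read in the group) and ANY
integral ideal `𝔟`, the type product `𝔞 := ∏_{g ∈ Φ} g • 𝔟` satisfies `(N𝔟) = 𝔞 · c•𝔞` (Shimura §8.3 Prop. 29 «`𝔟𝔟^ρ = N(𝔞)`» in the Galois
self-case: `𝔞 · c•𝔞 = ∏_{g ∈ Φ} g•𝔟 · ∏_{g ∈ cΦ = Φᶜ} g•𝔟 = ∏_{all g} g•𝔟 = (N𝔟)`, ★ `prod_map_eq_span_absNorm`).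
[cite: Shimura1998, §8.3 Prop. 29, p. 63] [cite: NeukirchANT1999, Ch. I Prop. 2.6 (iii)] -/
theorem span_absNorm_eq_typeProd_mul_complexConj_smul [IsGalois ℚ F] (Φ : Finset (F ≃ₐ[ℚ] F))
    (hΦ : ∀ g : F ≃ₐ[ℚ] F, g ∈ Φ ↔ ((IsCMField.complexConj F).restrictScalars ℚ) * g ∉ Φ) (𝔟 : Ideal (𝓞 F)) :
    Ideal.span {((Ideal.absNorm 𝔟 : ℕ) : 𝓞 F)} = (∏ g ∈ Φ, g • 𝔟) * (IsCMField.complexConj F) • (∏ g ∈ Φ, g • 𝔟) := by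
  classical
  set c : F ≃ₐ[ℚ] F := (IsCMField.complexConj F).restrictScalars ℚ with hc
  rw [← restrictScalars_complexConj_smul_ideal, ← hc, Finset.smul_prod']
  simp_rw [smul_smul]
  -- the CM condition: `g ↦ c̄ g` maps `Φ` onto its complement
  have hst : ∀ g : F ≃ₐ[ℚ] F, g ∈ Φ ↔ Equiv.mulLeft c g ∈ Φᶜ := fun g => by
    rw [Finset.mem_compl, Equiv.coe_mulLeft]
    exact hΦ g
  rw [Finset.prod_equiv (Equiv.mulLeft c) (s := Φ) (t := Φᶜ) (f := fun g => (c * g) • 𝔟) (g := fun h => h • 𝔟) hst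
      (fun g _ => rfl), Finset.prod_mul_prod_compl,
    ← Literature.NumberTheory.ComplexMultiplication.prod_map_eq_span_absNorm (AlgHom.id ℚ F) 𝔟]
  exact (Fintype.prod_equiv (algEquivEquivAlgHom ℚ F).toEquiv (fun g : F ≃ₐ[ℚ] F => g • 𝔟)
    (fun ψ : F →ₐ[ℚ] F => 𝔟.map (RingOfIntegers.mapRingHom (ψ : F →+* F))) fun g => rfl).symm

omit [IsCMField F] in
/-- **Row (b) for a type product**: if `𝔟 + (N) = (1)` then `∏_{g ∈ Φ} g•𝔟 + (N) = (1)` (each `g•𝔟 + (N) = g•(𝔟 + (N)) = (1)`, `N` rational).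
[cite: Shimura1998, §8.3 Prop. 29, p. 63] -/
theorem typeProd_sup_span_natCast_eq_top (Φ : Finset (F ≃ₐ[ℚ] F)) {𝔟 : Ideal (𝓞 F)} {N : ℕ}
    (h𝔟 : 𝔟 ⊔ Ideal.span {((N : ℕ) : 𝓞 F)} = ⊤) :
    (∏ g ∈ Φ, g • 𝔟) ⊔ Ideal.span {((N : ℕ) : 𝓞 F)} = ⊤ := by
  refine Ideal.prod_sup_eq_top fun g _ => ?_
  have h := congrArg (Ideal.map (MulSemiringAction.toRingHom (F ≃ₐ[ℚ] F) (𝓞 F) g)) h𝔟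
  rw [Ideal.map_sup, Ideal.map_top, Ideal.map_span, Set.image_singleton, map_natCast] at h
  rw [Ideal.pointwise_smul_def]
  exact h

omit [IsCMField F] in
/-- **Row (c) for a type product**: `𝔟 ≠ 0 ⇒ ∏_{g ∈ Φ} g•𝔟 ≠ 0`. [cite: Shimura1998, §8.3 Prop. 29, p. 63] -/
theorem typeProd_ne_bot (Φ : Finset (F ≃ₐ[ℚ] F)) {𝔟 : Ideal (𝓞 F)} (h𝔟 : 𝔟 ≠ ⊥) : (∏ g ∈ Φ, g • 𝔟) ≠ ⊥ := by
  have h' : ∀ g ∈ Φ, g • 𝔟 ≠ 0 := fun g _ h => h𝔟 (by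
    have h2 := congrArg (fun I : Ideal (𝓞 F) => g⁻¹ • I) h
    simp only [inv_smul_smul, smul_zero] at h2
    exact h2)
  exact Finset.prod_ne_zero_iff.mpr h'

/-- **THE GENERIC TWIST DATUM OF AN INTEGRAL IDEAL PRIME TO `N`** — rows (a)(b)(c) of `ETwistKerAt` ∕ `RecordESheetReading` for
`(twistIdeal, twistNorm) := (∏_{g ∈ Φ} g•𝔟, N𝔟)`: for `F ∕ ℚ` Galois CM, a CM type `Φ ⊆ Gal(F∕ℚ)` and an integral `𝔟 ≠ 0` with
`𝔟 + (N) = (1)`, the pair `𝔞 := ∏_{g ∈ Φ} g•𝔟`, `n := N𝔟` has `(n) = 𝔞 · c•𝔞`, `𝔞 + (N) = (1)`, `𝔞 ≠ 0`.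
[cite: Shimura1998, §8.3 Prop. 29, p. 63] [cite: RapoportSmithlingZhang2020Diagonal, §4.3 (4.23) p. 21] -/
theorem typeProd_twistRows [IsGalois ℚ F] (Φ : Finset (F ≃ₐ[ℚ] F))
    (hΦ : ∀ g : F ≃ₐ[ℚ] F, g ∈ Φ ↔ ((IsCMField.complexConj F).restrictScalars ℚ) * g ∉ Φ) {𝔟 : Ideal (𝓞 F)} {N : ℕ}
    (h𝔟0 : 𝔟 ≠ ⊥) (h𝔟N : 𝔟 ⊔ Ideal.span {((N : ℕ) : 𝓞 F)} = ⊤) :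
    Ideal.span {((Ideal.absNorm 𝔟 : ℕ) : 𝓞 F)} = (∏ g ∈ Φ, g • 𝔟) * (IsCMField.complexConj F) • (∏ g ∈ Φ, g • 𝔟) ∧
    (∏ g ∈ Φ, g • 𝔟) ⊔ Ideal.span {((N : ℕ) : 𝓞 F)} = ⊤ ∧ (∏ g ∈ Φ, g • 𝔟) ≠ ⊥ :=
  ⟨span_absNorm_eq_typeProd_mul_complexConj_smul Φ hΦ 𝔟, typeProd_sup_span_natCast_eq_top Φ h𝔟N, typeProd_ne_bot Φ h𝔟0⟩

/-! ### §2 Level-adapted Artin correspondents: `s ↔ σ` with `(s) = 𝔟` integral prime to `𝔪` and `s ≡ 1 mod 𝔪` -/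

/-- **Every `σ ∈ Aut(ℂ∕τF)` has a LEVEL-ADAPTED INTEGRAL Artin correspondent**: a finite idèle `s ↔ σ` (★ `IsArtinCorrespondent`) whose
ideal `(s) = 𝔟` is integral and prime to `𝔪` and whose components at the primes of `𝔪` satisfy `|s_v|_v = 1`, `|s_v − 1|_v ≤ q_v^{-n_v}`
(`s_v ≡ 1 mod 𝔪`) — ★ `exists_finiteIdele_isArtinCorrespondent` + ★ `exists_mul_unitEmbedding_integral_congr` + ★
`IsArtinCorrespondent.mul_unitEmbedding_inv` («`F^×`-changes of `s` move `𝔞_γ` in its class», A-p01 memo §1 ∕ §3 (iii)).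
[cite: Milne2005ShimuraVarieties, (59) p. 107] [cite: NeukirchANT1999, Ch. VI §1 Prop. (1.9) pp. 364–365] -/
theorem exists_isArtinCorrespondent_integral_congr (τ : F →+* ℂ) (σ : ℂ ≃+* ℂ) (hσ : ∀ x : F, σ (τ x) = τ x)
    {𝔪 : Ideal (𝓞 F)} (h𝔪 : 𝔪 ≠ ⊥) :
    ∃ (s : (FiniteAdeleRing (𝓞 F) F)ˣ) (𝔟 : Ideal (𝓞 F)),
      UnitaryCanonicalModel.IsArtinCorrespondent F τ s σ ∧ 𝔟 ≠ ⊥ ∧ IsCoprime 𝔟 𝔪 ∧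
      Literature.NumberTheory.Automorphic.FiniteAdeleRing.toFractionalIdeal (𝓞 F) F s = (𝔟 : FractionalIdeal (𝓞 F)⁰ F) ∧
      ∀ v : HeightOneSpectrum (𝓞 F), 𝔪 ≤ v.asIdeal →
        Valued.v ((s : FiniteAdeleRing (𝓞 F) F) v) = 1 ∧
        Valued.v ((s : FiniteAdeleRing (𝓞 F) F) v - 1) ≤ WithZero.exp (-(modulusExp 𝔪 v : ℤ)) := by
  obtain ⟨s₀, hs₀⟩ :=
    Literature.AlgebraicGeometry.ShimuraVarieties.UnitaryCanonicalModel.exists_finiteIdele_isArtinCorrespondent F τ σ hσ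
  obtain ⟨a, 𝔟, h𝔟, hcop, hid, hv⟩ :=
    Literature.NumberTheory.GaloisRepresentations.exists_mul_unitEmbedding_integral_congr h𝔪 s₀
  refine ⟨s₀ * FiniteAdeleRing.unitEmbedding (𝓞 F) F a, 𝔟, ?_, h𝔟, hcop, hid, hv⟩
  have h := hs₀.mul_unitEmbedding_inv F τ a⁻¹
  rwa [map_inv, inv_inv] at h

/-- **Re-adapting a GIVEN correspondent inside its class**: if `s ↔ σ` then `s·a ↔ σ` for some `a ∈ F^×` with `(s·a) = 𝔟` integral prime to `𝔪`
and `s·a ≡ 1 mod 𝔪`. [cite: Milne2005ShimuraVarieties, (59) p. 107] [cite: NeukirchANT1999, Ch. VI §1 Prop. (1.9) pp. 364–365] -/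
theorem exists_mul_unitEmbedding_isArtinCorrespondent_integral_congr {τ : F →+* ℂ} {σ : ℂ ≃+* ℂ} {s : (FiniteAdeleRing (𝓞 F) F)ˣ}
    (hs : UnitaryCanonicalModel.IsArtinCorrespondent F τ s σ) {𝔪 : Ideal (𝓞 F)} (h𝔪 : 𝔪 ≠ ⊥) :
    ∃ (a : Fˣ) (𝔟 : Ideal (𝓞 F)),
      UnitaryCanonicalModel.IsArtinCorrespondent F τ (s * FiniteAdeleRing.unitEmbedding (𝓞 F) F a) σ ∧ 𝔟 ≠ ⊥ ∧ IsCoprime 𝔟 𝔪 ∧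
      Literature.NumberTheory.Automorphic.FiniteAdeleRing.toFractionalIdeal (𝓞 F) F (s * FiniteAdeleRing.unitEmbedding (𝓞 F) F a) =
        (𝔟 : FractionalIdeal (𝓞 F)⁰ F) ∧
      ∀ v : HeightOneSpectrum (𝓞 F), 𝔪 ≤ v.asIdeal →
        Valued.v (((s * FiniteAdeleRing.unitEmbedding (𝓞 F) F a : (FiniteAdeleRing (𝓞 F) F)ˣ) : FiniteAdeleRing (𝓞 F) F) v) = 1 ∧
        Valued.v (((s * FiniteAdeleRing.unitEmbedding (𝓞 F) F a : (FiniteAdeleRing (𝓞 F) F)ˣ) : FiniteAdeleRing (𝓞 F) F) v - 1) ≤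
          WithZero.exp (-(modulusExp 𝔪 v : ℤ)) := by
  obtain ⟨a, 𝔟, h𝔟, hcop, hid, hv⟩ :=
    Literature.NumberTheory.GaloisRepresentations.exists_mul_unitEmbedding_integral_congr h𝔪 s
  refine ⟨a, 𝔟, ?_, h𝔟, hcop, hid, hv⟩
  have h := hs.mul_unitEmbedding_inv F τ a⁻¹
  rwa [map_inv, inv_inv] at h

/-! ### §3 HEAD — the twist data `(𝔞_γ, n_γ)_γ`: the `if`-ZIP over the Frobenius readings -/

/-- **HEAD (S6) «TWIST DATA», abstract form.**  Given: a «Frobenius» predicate `Frob` on the sheet group `Γ`; ONE distinguished datum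
`(𝔞₀, n₀)` with rows (a)(b)(c) (the consumer՚s `(𝔞_can(m₁, τR₁, w), p^f)`, ★ p849355); an admissibility predicate `Adm γ 𝔞 n` (whatever the
geometric rows (K-law)∕(cover) need of the datum — the class condition) which `(𝔞₀, n₀)` meets on the Frobenius readings and which SOME datum with
rows (a)(b)(c) meets at every `γ` (§1 + §2): there are `twistIdeal`, `twistNorm` with rows (a)(b)(c) everywhere, EQUAL TO `(𝔞₀, n₀)` on the
Frobenius readings (so every Frobenius-conditioned row of the letter is the corresponding ★ row of `𝔞₀`), and admissible everywhere.
(`twistIdeal γ := if Frob γ then 𝔞₀ else` a chosen admissible datum.) [cite: Shimura1998, §13.1 Thm. 1 pp. 97–99; §18.6 Thm. 18.6 pp. 124–125]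
[cite: RapoportSmithlingZhang2020Diagonal, §4.3 (4.23) p. 21] -/
theorem exists_twistData {Γ : Type*} (Frob : Γ → Prop) (Adm : Γ → Ideal (𝓞 F) → ℕ → Prop) (N : ℕ) (𝔞₀ : Ideal (𝓞 F)) (n₀ : ℕ)
    (h₀a : Ideal.span {((n₀ : ℕ) : 𝓞 F)} = 𝔞₀ * (IsCMField.complexConj F) • 𝔞₀)
    (h₀b : 𝔞₀ ⊔ Ideal.span {((N : ℕ) : 𝓞 F)} = ⊤) (h₀c : 𝔞₀ ≠ ⊥) (h₀adm : ∀ γ, Frob γ → Adm γ 𝔞₀ n₀)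
    (hgen : ∀ γ, ∃ (𝔞 : Ideal (𝓞 F)) (n : ℕ), Adm γ 𝔞 n ∧
      Ideal.span {((n : ℕ) : 𝓞 F)} = 𝔞 * (IsCMField.complexConj F) • 𝔞 ∧ 𝔞 ⊔ Ideal.span {((N : ℕ) : 𝓞 F)} = ⊤ ∧ 𝔞 ≠ ⊥) :
    ∃ (twistIdeal : Γ → Ideal (𝓞 F)) (twistNorm : Γ → ℕ),
      (∀ γ, Ideal.span {((twistNorm γ : ℕ) : 𝓞 F)} = twistIdeal γ * (IsCMField.complexConj F) • twistIdeal γ) ∧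
      (∀ γ, twistIdeal γ ⊔ Ideal.span {((N : ℕ) : 𝓞 F)} = ⊤) ∧
      (∀ γ, twistIdeal γ ≠ ⊥) ∧
      (∀ γ, Frob γ → twistIdeal γ = 𝔞₀ ∧ twistNorm γ = n₀) ∧
      (∀ γ, Adm γ (twistIdeal γ) (twistNorm γ)) := by
  classical
  choose 𝔞g ng hg using hgen
  refine ⟨fun γ => if Frob γ then 𝔞₀ else 𝔞g γ, fun γ => if Frob γ then n₀ else ng γ,
    fun γ => ?_, fun γ => ?_, fun γ => ?_, fun γ h => ⟨if_pos h, if_pos h⟩, fun γ => ?_⟩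
  · by_cases h : Frob γ
    · simp only [if_pos h]; exact h₀a
    · simp only [if_neg h]; exact (hg γ).2.1
  · by_cases h : Frob γ
    · simp only [if_pos h]; exact h₀b
    · simp only [if_neg h]; exact (hg γ).2.2.1
  · by_cases h : Frob γ
    · simp only [if_pos h]; exact h₀c
    · simp only [if_neg h]; exact (hg γ).2.2.2
  · by_cases h : Frob γ
    · simp only [if_pos h]; exact h₀adm γ h
    · simp only [if_neg h]; exact (hg γ).1

section Letter

variable (w : HeightOneSpectrum (𝓞 F)) {Fi : Type} [Field Fi] [Algebra F Fi]
  (e : Fi →ₐ[F] AlgebraicClosure (w.adicCompletion F))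
  {L : Type} [Field L] (ι₁ : F →+* L) (M : (F →+* L) → ℕ)

/-- **HEAD (S6) «TWIST DATA», LETTER-SHAPED** — the seven arithmetic rows of `RecordESheetReading` ∕ `ETwistKerAt` (a)(b)(c)(FROB-𝔞)(FROB-n)(π1)
(FROB-can), with the letter՚s binders token for token (`M := mOf ι₁ Φ`, `L := ℂ` at the consumer), PLUS admissibility of every datum for the two
geometric rows.  Inputs: the six ★ p849355 rows of the Shimura–Taniyama datum `(𝔞₀, p^f)` = `canonicalTwistIdeal_eLetterRows_sigma` (`𝔞₀` = the
`(σ₁, τR₁)`-token of `𝔞_can`), the admissibility of `(𝔞₀, p^f)` at every `γ` READ BY AN ARITHMETIC FROBENIUS AT `w` ON THE SHEET `e` (the (S7) pin +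
coset consistency, supplied by the Frobenius-pin organ), and the generic admissible datum with rows (a)(b)(c) at every `γ` (§1–§2 + the class organ).
Output: `twistIdeal γ := 𝔞₀` on the Frobenius readings of `e`, a generic admissible datum elsewhere.
[cite: Shimura1998, §13.1 Thm. 1 pp. 97–99; §18.6 Thm. 18.6 pp. 124–125] [cite: RapoportSmithlingZhang2020Diagonal, §3.2 p. 11; §4.3 (4.23) p. 21] -/
theorem exists_twistData_letterRows (N p f : ℕ) (𝔞₀ : Ideal (𝓞 F))
    (h₀a : Ideal.span {((p ^ f : ℕ) : 𝓞 F)} = 𝔞₀ * (IsCMField.complexConj F) • 𝔞₀)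
    (h₀b : 𝔞₀ ⊔ Ideal.span {((N : ℕ) : 𝓞 F)} = ⊤) (h₀c : 𝔞₀ ≠ ⊥) (h₀w : w.asIdeal ∣ 𝔞₀)
    (h₀π : 𝔞₀ ⊔ (((IsCMField.complexConj F) • w).asIdeal : Ideal (𝓞 F)) = ⊤)
    (h₀can : ∀ (σ₀ : AlgebraicClosure (w.adicCompletion F) →+* L), σ₀.comp (algebraMap F (AlgebraicClosure (w.adicCompletion F))) = ι₁ →
      ∀ (τR : (F →+* AlgebraicClosure (w.adicCompletion F)) → (𝓞 F →+* ↥(closureValuationSubring (w.adicCompletion F)))),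
        (∀ (τ : F →+* AlgebraicClosure (w.adicCompletion F)) (x : 𝓞 F),
          ((τR τ x : ↥(closureValuationSubring (w.adicCompletion F))) : AlgebraicClosure (w.adicCompletion F)) = τ (x : F)) →
      𝔞₀ = ∏ τ ∈ Finset.univ.filter (fun τ : F →+* AlgebraicClosure (w.adicCompletion F) =>
            M (σ₀.comp τ) ≠ 0 ∧ RingHom.ker ((residue ↥(closureValuationSubring (w.adicCompletion F))).comp (τR τ)) ≠
              (((IsCMField.complexConj F) • w).asIdeal : Ideal (𝓞 F))),
          RingHom.ker ((residue ↥(closureValuationSubring (w.adicCompletion F))).comp (τR τ)))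
    (Adm : (Fi ≃ₐ[F] Fi) → Ideal (𝓞 F) → ℕ → Prop)
    (h₀adm : ∀ (σ : Field.absoluteGaloisGroup (w.adicCompletion F)), IsAbsArithFrob σ → ∀ γ : Fi ≃ₐ[F] Fi,
      ((AlgEquiv.restrictScalars F (Field.absoluteGaloisGroup.toAlgEquiv (w.adicCompletion F) σ) :
          AlgebraicClosure (w.adicCompletion F) ≃ₐ[F] AlgebraicClosure (w.adicCompletion F)) :
          AlgebraicClosure (w.adicCompletion F) →ₐ[F] AlgebraicClosure (w.adicCompletion F)).comp e = e.comp (γ : Fi →ₐ[F] Fi) →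
      Adm γ 𝔞₀ (p ^ f))
    (hgen : ∀ γ : Fi ≃ₐ[F] Fi, ∃ (𝔞 : Ideal (𝓞 F)) (n : ℕ), Adm γ 𝔞 n ∧
      Ideal.span {((n : ℕ) : 𝓞 F)} = 𝔞 * (IsCMField.complexConj F) • 𝔞 ∧ 𝔞 ⊔ Ideal.span {((N : ℕ) : 𝓞 F)} = ⊤ ∧ 𝔞 ≠ ⊥) :
    ∃ (twistIdeal : (Fi ≃ₐ[F] Fi) → Ideal (𝓞 F)) (twistNorm : (Fi ≃ₐ[F] Fi) → ℕ),
    (∀ γ : Fi ≃ₐ[F] Fi, Ideal.span {((twistNorm γ : ℕ) : 𝓞 F)} = twistIdeal γ * (IsCMField.complexConj F) • twistIdeal γ) ∧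
    (∀ γ : Fi ≃ₐ[F] Fi, twistIdeal γ ⊔ Ideal.span {((N : ℕ) : 𝓞 F)} = ⊤) ∧
    (∀ γ : Fi ≃ₐ[F] Fi, twistIdeal γ ≠ ⊥) ∧
    (∀ (σ : Field.absoluteGaloisGroup (w.adicCompletion F)), IsAbsArithFrob σ → ∀ γ : Fi ≃ₐ[F] Fi,
      ((AlgEquiv.restrictScalars F (Field.absoluteGaloisGroup.toAlgEquiv (w.adicCompletion F) σ) :
          AlgebraicClosure (w.adicCompletion F) ≃ₐ[F] AlgebraicClosure (w.adicCompletion F)) :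
          AlgebraicClosure (w.adicCompletion F) →ₐ[F] AlgebraicClosure (w.adicCompletion F)).comp e = e.comp (γ : Fi →ₐ[F] Fi) →
      w.asIdeal ∣ twistIdeal γ) ∧
    (∀ (σ : Field.absoluteGaloisGroup (w.adicCompletion F)), IsAbsArithFrob σ → ∀ γ : Fi ≃ₐ[F] Fi,
      ((AlgEquiv.restrictScalars F (Field.absoluteGaloisGroup.toAlgEquiv (w.adicCompletion F) σ) :
          AlgebraicClosure (w.adicCompletion F) ≃ₐ[F] AlgebraicClosure (w.adicCompletion F)) :
          AlgebraicClosure (w.adicCompletion F) →ₐ[F] AlgebraicClosure (w.adicCompletion F)).comp e = e.comp (γ : Fi →ₐ[F] Fi) →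
      twistNorm γ = p ^ f) ∧
    (∀ (σ : Field.absoluteGaloisGroup (w.adicCompletion F)), IsAbsArithFrob σ → ∀ γ : Fi ≃ₐ[F] Fi,
      ((AlgEquiv.restrictScalars F (Field.absoluteGaloisGroup.toAlgEquiv (w.adicCompletion F) σ) :
          AlgebraicClosure (w.adicCompletion F) ≃ₐ[F] AlgebraicClosure (w.adicCompletion F)) :
          AlgebraicClosure (w.adicCompletion F) →ₐ[F] AlgebraicClosure (w.adicCompletion F)).comp e = e.comp (γ : Fi →ₐ[F] Fi) →
      twistIdeal γ ⊔ (((IsCMField.complexConj F) • w).asIdeal : Ideal (𝓞 F)) = ⊤) ∧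
    (∀ (σ₀ : AlgebraicClosure (w.adicCompletion F) →+* L), σ₀.comp (algebraMap F (AlgebraicClosure (w.adicCompletion F))) = ι₁ →
      ∀ (τR : (F →+* AlgebraicClosure (w.adicCompletion F)) → (𝓞 F →+* ↥(closureValuationSubring (w.adicCompletion F)))),
        (∀ (τ : F →+* AlgebraicClosure (w.adicCompletion F)) (x : 𝓞 F),
          ((τR τ x : ↥(closureValuationSubring (w.adicCompletion F))) : AlgebraicClosure (w.adicCompletion F)) = τ (x : F)) →
      ∀ (σ : Field.absoluteGaloisGroup (w.adicCompletion F)), IsAbsArithFrob σ → ∀ γ : Fi ≃ₐ[F] Fi,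
        ((AlgEquiv.restrictScalars F (Field.absoluteGaloisGroup.toAlgEquiv (w.adicCompletion F) σ) :
            AlgebraicClosure (w.adicCompletion F) ≃ₐ[F] AlgebraicClosure (w.adicCompletion F)) :
            AlgebraicClosure (w.adicCompletion F) →ₐ[F] AlgebraicClosure (w.adicCompletion F)).comp e = e.comp (γ : Fi →ₐ[F] Fi) →
        twistIdeal γ = ∏ τ ∈ Finset.univ.filter (fun τ : F →+* AlgebraicClosure (w.adicCompletion F) =>
            M (σ₀.comp τ) ≠ 0 ∧ RingHom.ker ((residue ↥(closureValuationSubring (w.adicCompletion F))).comp (τR τ)) ≠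
              (((IsCMField.complexConj F) • w).asIdeal : Ideal (𝓞 F))),
          RingHom.ker ((residue ↥(closureValuationSubring (w.adicCompletion F))).comp (τR τ))) ∧
    (∀ γ : Fi ≃ₐ[F] Fi, Adm γ (twistIdeal γ) (twistNorm γ)) := by
  -- the `if`-branch := «γ is read on `e` by SOME arithmetic Frobenius at `w`» (the rows՚ own hypothesis)
  obtain ⟨tI, tN, ha, hb, hc, hfrob, hadm⟩ := exists_twistData
    (fun γ : Fi ≃ₐ[F] Fi => ∃ σ : Field.absoluteGaloisGroup (w.adicCompletion F), IsAbsArithFrob σ ∧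
      ((AlgEquiv.restrictScalars F (Field.absoluteGaloisGroup.toAlgEquiv (w.adicCompletion F) σ) :
          AlgebraicClosure (w.adicCompletion F) ≃ₐ[F] AlgebraicClosure (w.adicCompletion F)) :
          AlgebraicClosure (w.adicCompletion F) →ₐ[F] AlgebraicClosure (w.adicCompletion F)).comp e = e.comp (γ : Fi →ₐ[F] Fi))
    Adm N 𝔞₀ (p ^ f) h₀a h₀b h₀c (fun γ ⟨σ, hσ, hγ⟩ => h₀adm σ hσ γ hγ) hgen
  refine ⟨tI, tN, ha, hb, hc, fun σ hσ γ hγ => ?_, fun σ hσ γ hγ => (hfrob γ ⟨σ, hσ, hγ⟩).2, fun σ hσ γ hγ => ?_,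
    fun σ₀ hσ₀ τR hτR σ hσ γ hγ => ?_, hadm⟩
  · rw [(hfrob γ ⟨σ, hσ, hγ⟩).1]; exact h₀w
  · rw [(hfrob γ ⟨σ, hσ, hγ⟩).1]; exact h₀π
  · rw [(hfrob γ ⟨σ, hσ, hγ⟩).1]; exact h₀can σ₀ hσ₀ τR hτR

end Letter

end Summit.HodgeConjecture.HodgeConjecture.Theorems.F0P6aTwistData

end
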